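import Literature.NumberTheory.Automorphic.HyperspecialUnitarySatakeIsomorphism
import Literature.NumberTheory.Automorphic.FixedPointSubalgebraCharacters
import Literature.NumberTheory.Automorphic.HyperspecialUnitaryHeckeEigencharacter
import HarnessLib

/-!
# Every character of `ℋ(U(σ, J₀), K₀)` is an unramified Hecke eigencharacter `λ_β` (Cartier 1979 §IV Cor. 4.2, existence, in
# every rank)

Topic `NumberTheory/Automorphic`; namespace `Literature.NumberTheory.Automorphic.HermitianLattice[.UnramifiedLocalConjDatum]`
(lane `lit-hodgefound`, Track 2 foundations; seat `lit-hodgefound-p11`, generation 48, row g48-#9).  DEFINITIONS with bodies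
(`revCentralizer`, `antisymmLatticeCongr`, `weylAlgAut`, `weylAction`, `embLaurent`, `siegelRetract`) + theorems; no named fact,
no instance (the `W`-action on `ℂ[Λ⁻]` is a `def`, used through `letI`), no notation.

## The mathematics

`G = U_N = U(σ, J₀^{(N)})` (unramified conjugation datum, `σ ≠ id`, finite residue field), `K₀` hyperspecial,
`𝒮 : ℋ(G, K₀) ⥲ ℂ[Λ⁻]^W` the Satake isomorphism (`HyperspecialUnitarySatakeIsomorphism.satakeAlgEquiv`), `Λ⁻ ⊆ ℤ^N` the
antisymmetric cocharacters, `W = C_{S_N}(rev)`.  [CartierCorvallis1979] §IV Cor. 4.2: «the homomorphisms `ℋ(G, K) → ℂ` are the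
`f ↦ Sf(χ)`, `χ` an unramified character of the torus».  PROOF OF EXISTENCE: a character `ψ` of `ℋ(G, K₀)` is, through `𝒮`, a
character `φ` of `ℂ[Λ⁻]^W`; `W` is finite and `ℂ[Λ⁻]^W` is its algebra of invariants in `ℂ[Λ⁻]`, so `φ` extends to a character
`Ψ` of `ℂ[Λ⁻]` (`FixedPointSubalgebraCharacters.exists_algHom_extend_of_fixedPoints`: integrality + lying over + Nullstellensatz);
characters of the group algebra `ℂ[Λ⁻]` are characters `χ₀` of the lattice `Λ⁻`, which extend to `ℤ^N` along the Siegel retraction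
`ℤ^N → Λ⁻` (`μ ↦ ι(μ|_{[0,n)})`, `HyperspecialUnitarySatakeSiegelDescent.siegelExp`), i.e. are restrictions of monomial characters
`μ ↦ β^μ`, `β ∈ (ℂˣ)^N`; unwinding, `ψ(T) = 𝒮(T)(β) = λ_β(T)` (`HyperspecialUnitaryHeckeEigencharacter.heckeEigencharacter`).

## What is formalised

* §1 `revCentralizer N = W ≤ S_N`, `antisymmLatticeCongr` (its action on `Λ⁻`), `weylAlgAut`, `weylAction` (the action on `ℂ[Λ⁻]` by
  algebra automorphisms), `embLaurent ι_* : ℂ[Λ⁻] → ℂ[ℤ^N]` with its coefficients, **`smul_eq_self_iff_coeff`** and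
  **`forall_smul_eq_self_iff_mem_unitarySatakeTarget`** (`ℂ[Λ⁻]^W` is `ι_*⁻¹(unitarySatakeTarget)`).
* §2 `siegelExp_mem_antisymmLattice`, `siegelRetract` (a retraction `ℤ^N →+ Λ⁻`), `siegelRetract_coe`.
* §3 **`exists_eq_heckeEigencharacter`**: every `ψ : ℋ(U(σ, J₀^{(N)}), K₀) →ₐ[ℂ] ℂ` is `λ_β` for some `β ∈ (ℂˣ)^N`.

## References
* [CartierCorvallis1979] P. Cartier, *Representations of 𝔭-adic groups: a survey*, PSPM 33.1 (1979), §IV Cor. 4.2.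
* [Satake1963] I. Satake, *Theory of spherical functions on reductive algebraic groups over 𝔭-adic fields*, Publ. Math. IHÉS 18
  (1963), §6.
* [Minguez2011] A. Mínguez, *Unramified representations of unitary groups*, in: *On the stabilization of the trace formula* (2011), §4.
* [Macdonald1971] I. G. Macdonald, *Spherical functions on a group of p-adic type*, Madras (1971), Ch. III §3, Ch. IV.
-/

noncomputable section

open scoped Valued WithZero Matrix MatrixGroups
open MonoidAlgebra Representation

namespace Literature.NumberTheory.Automorphic.HermitianLattice

open Literature.NumberTheory.Automorphic Literature.NumberTheory.Automorphic.CartanUnique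

variable {N : ℕ}

/-! ## §1 `W = C_{S_N}(rev)` acting on `Λ⁻` and on `ℂ[Λ⁻]` -/

section Weyl

variable (N) in
/-- **`W = C_{S_N}(rev)`**, the Weyl group of `U(σ, J₀^{(N)})` as the group of coordinate permutations commuting with `rev`.
[cite: CartierCorvallis1979, §IV Cor. 4.2] -/
def revCentralizer : Subgroup (Equiv.Perm (Fin N)) where
  carrier := {π | ∀ i, π (Fin.rev i) = Fin.rev (π i)}
  mul_mem' hπ hρ := perm_mul_rev hπ hρ
  one_mem' _ := rfl
  inv_mem' hπ := perm_inv_rev hπ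

/-- Membership in `W`. [cite: CartierCorvallis1979, §IV Cor. 4.2] -/
theorem mem_revCentralizer_iff (π : Equiv.Perm (Fin N)) : π ∈ revCentralizer N ↔ ∀ i, π (Fin.rev i) = Fin.rev (π i) := Iff.rfl

/-- `Λ⁻` is stable under `W`: `μ ∘ π ∈ Λ⁻`. [cite: CartierCorvallis1979, §IV Cor. 4.2] -/
theorem comp_mem_antisymmLattice {μ : Fin N → ℤ} (hμ : μ ∈ antisymmLattice N) {π : Equiv.Perm (Fin N)}
    (hπ : π ∈ revCentralizer N) : μ ∘ ⇑π ∈ antisymmLattice N := fun i => by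
  rw [Function.comp_apply, Function.comp_apply, hπ i, hμ]

/-- **The action of `π ∈ W` on `Λ⁻`**: `μ ↦ μ ∘ π⁻¹`. [cite: CartierCorvallis1979, §IV Cor. 4.2] -/
def antisymmLatticeCongr (π : revCentralizer N) : antisymmLattice N ≃+ antisymmLattice N where
  toFun μ := ⟨μ.1 ∘ ⇑((π⁻¹ : revCentralizer N) : Equiv.Perm (Fin N)), comp_mem_antisymmLattice μ.2 (π⁻¹).2⟩
  invFun μ := ⟨μ.1 ∘ ⇑(π : Equiv.Perm (Fin N)), comp_mem_antisymmLattice μ.2 π.2⟩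
  left_inv μ := by
    apply Subtype.ext; funext i
    simp only [Function.comp_apply, Subgroup.coe_inv, Equiv.Perm.inv_def, Equiv.symm_apply_apply]
  right_inv μ := by
    apply Subtype.ext; funext i
    simp only [Function.comp_apply, Subgroup.coe_inv, Equiv.Perm.inv_def, Equiv.apply_symm_apply]
  map_add' μ ν := rfl

/-- `(π · μ) = μ ∘ π⁻¹` on `Λ⁻`. [cite: CartierCorvallis1979, §IV Cor. 4.2] -/
theorem coe_antisymmLatticeCongr (π : revCentralizer N) (μ : antisymmLattice N) :
    ((antisymmLatticeCongr π μ : antisymmLattice N) : Fin N → ℤ) = (μ : Fin N → ℤ) ∘ ⇑((π : Equiv.Perm (Fin N))⁻¹) := rfl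

/-- `(π · )⁻¹ μ = μ ∘ π` on `Λ⁻`. [cite: CartierCorvallis1979, §IV Cor. 4.2] -/
theorem coe_antisymmLatticeCongr_symm (π : revCentralizer N) (μ : antisymmLattice N) :
    (((antisymmLatticeCongr π).symm μ : antisymmLattice N) : Fin N → ℤ) = (μ : Fin N → ℤ) ∘ ⇑(π : Equiv.Perm (Fin N)) := rfl

variable (N) in
/-- **`W` acting on `ℂ[Λ⁻]` by algebra automorphisms** (`π ↦ (x^μ ↦ x^{μ ∘ π⁻¹})`). [cite: CartierCorvallis1979, §IV Cor. 4.2] -/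
def weylAlgAut : revCentralizer N →* (AddMonoidAlgebra ℂ (antisymmLattice N) ≃ₐ[ℂ] AddMonoidAlgebra ℂ (antisymmLattice N)) where
  toFun π := AddMonoidAlgebra.domCongr ℂ ℂ (antisymmLatticeCongr π)
  map_one' := by
    refine AlgEquiv.ext fun f => AddMonoidAlgebra.ext (Finsupp.ext fun m => ?_)
    rw [AddMonoidAlgebra.coeff_domCongr, AlgEquiv.one_apply]
    rfl
  map_mul' π ρ := by
    refine AlgEquiv.ext fun f => AddMonoidAlgebra.ext (Finsupp.ext fun m => ?_)
    rw [AddMonoidAlgebra.coeff_domCongr, AlgEquiv.mul_apply, AddMonoidAlgebra.coeff_domCongr, AddMonoidAlgebra.coeff_domCongr]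
    rfl

variable (N) in
/-- The `W`-action on `ℂ[Λ⁻]` as a `MulSemiringAction` (a definition, used through `letI`). [cite: CartierCorvallis1979, §IV Cor. 4.2] -/
@[reducible] def weylAction : MulSemiringAction (revCentralizer N) (AddMonoidAlgebra ℂ (antisymmLattice N)) :=
  MulSemiringAction.compHom _ (weylAlgAut N)

/-- Under `weylAction`, `π • f = domCongr (π ·) f`. [cite: CartierCorvallis1979, §IV Cor. 4.2] -/
theorem weylAction_smul (π : revCentralizer N) (f : AddMonoidAlgebra ℂ (antisymmLattice N)) :
    (letI := weylAction N; π • f) = AddMonoidAlgebra.domCongr ℂ ℂ (antisymmLatticeCongr π) f := rfl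

variable (N) in
/-- **`ι_* : ℂ[Λ⁻] → ℂ[ℤ^N]`**, the embedding of group algebras along `Λ⁻ ⊆ ℤ^N` (its range is `antisymmSupported ℂ N`).
[cite: CartierCorvallis1979, §IV.2] -/
def embLaurent : AddMonoidAlgebra ℂ (antisymmLattice N) →ₐ[ℂ] AddMonoidAlgebra ℂ (Fin N → ℤ) :=
  AddMonoidAlgebra.mapDomainAlgHom ℂ ℂ (antisymmLattice N).subtype

/-- `ι_* b = mapDomain (↑) b`. [cite: CartierCorvallis1979, §IV.2] -/
theorem embLaurent_apply (b : AddMonoidAlgebra ℂ (antisymmLattice N)) :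
    embLaurent N b = AddMonoidAlgebra.mapDomain (antisymmLattice N).subtype b := by
  rw [embLaurent, AddMonoidAlgebra.mapDomainAlgHom_apply]

/-- The coefficients of `ι_* b` on `Λ⁻`. [cite: CartierCorvallis1979, §IV.2] -/
theorem coeff_embLaurent_coe (b : AddMonoidAlgebra ℂ (antisymmLattice N)) (m : antisymmLattice N) :
    (embLaurent N b).coeff (m : Fin N → ℤ) = b.coeff m := by
  rw [embLaurent_apply, AddMonoidAlgebra.mapDomain, AddMonoidAlgebra.coeff_ofCoeff]
  exact Finsupp.mapDomain_apply Subtype.val_injective _ _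

/-- The coefficients of `ι_* b` vanish off `Λ⁻`. [cite: CartierCorvallis1979, §IV.2] -/
theorem coeff_embLaurent_of_not_mem (b : AddMonoidAlgebra ℂ (antisymmLattice N)) {μ : Fin N → ℤ} (hμ : μ ∉ antisymmLattice N) :
    (embLaurent N b).coeff μ = 0 := by
  rw [embLaurent_apply, AddMonoidAlgebra.mapDomain, AddMonoidAlgebra.coeff_ofCoeff]
  exact Finsupp.mapDomain_notin_range _ _ fun ⟨ν, hν⟩ => hμ (by rw [← hν]; exact ν.2)

/-- `ι_* b ∈ ℂ[Λ⁻] ⊆ ℂ[ℤ^N]`. [cite: CartierCorvallis1979, §IV.2] -/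
theorem embLaurent_mem_antisymmSupported (b : AddMonoidAlgebra ℂ (antisymmLattice N)) : embLaurent N b ∈ antisymmSupported ℂ N :=
  (AlgHom.mem_range _).2 ⟨b, rfl⟩

/-- **`π • b = b` iff the coefficients of `ι_* b` are `π`-invariant.** [cite: CartierCorvallis1979, §IV Cor. 4.2] -/
theorem smul_eq_self_iff_coeff (π : revCentralizer N) (b : AddMonoidAlgebra ℂ (antisymmLattice N)) :
    (letI := weylAction N; π • b) = b ↔ ∀ μ : Fin N → ℤ, (embLaurent N b).coeff (μ ∘ ⇑(π : Equiv.Perm (Fin N))) = (embLaurent N b).coeff μ := by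
  rw [weylAction_smul]
  constructor
  · intro h μ
    by_cases hμ : μ ∈ antisymmLattice N
    · have h1 := congrArg (fun f => f.coeff ⟨μ, hμ⟩) h
      simp only [AddMonoidAlgebra.coeff_domCongr] at h1
      have e1 : (embLaurent N b).coeff (μ ∘ ⇑(π : Equiv.Perm (Fin N))) = b.coeff ((antisymmLatticeCongr π).symm ⟨μ, hμ⟩) :=
        coeff_embLaurent_coe b ((antisymmLatticeCongr π).symm ⟨μ, hμ⟩)
      have e2 : (embLaurent N b).coeff μ = b.coeff ⟨μ, hμ⟩ := coeff_embLaurent_coe b ⟨μ, hμ⟩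
      rw [e1, e2]
      exact h1
    · have hμ' : μ ∘ ⇑(π : Equiv.Perm (Fin N)) ∉ antisymmLattice N := fun h' => hμ (by
        have h2 := comp_mem_antisymmLattice h' (π⁻¹).2
        rwa [Function.comp_assoc, ← Equiv.Perm.coe_mul, Subgroup.coe_inv, mul_inv_cancel, Equiv.Perm.coe_one,
          Function.comp_id] at h2)
      rw [coeff_embLaurent_of_not_mem b hμ, coeff_embLaurent_of_not_mem b hμ']
  · intro h
    refine AddMonoidAlgebra.ext (Finsupp.ext fun m => ?_)
    rw [AddMonoidAlgebra.coeff_domCongr, ← coeff_embLaurent_coe, ← coeff_embLaurent_coe, coe_antisymmLatticeCongr_symm]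
    exact h m

/-- **`ℂ[Λ⁻]^W = ι_*⁻¹(ℂ[Λ⁻]^W ⊆ ℂ[ℤ^N])`**: `b` is fixed by `W` iff `ι_* b ∈ unitarySatakeTarget ℂ N`. [cite: CartierCorvallis1979, §IV Cor. 4.2] -/
theorem forall_smul_eq_self_iff_mem_unitarySatakeTarget (b : AddMonoidAlgebra ℂ (antisymmLattice N)) :
    (∀ π : revCentralizer N, (letI := weylAction N; π • b) = b) ↔ embLaurent N b ∈ unitarySatakeTarget ℂ N := by
  rw [unitarySatakeTarget, Algebra.mem_inf, mem_weylInvariants_unitarySatakeWeylGroup_iff]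
  constructor
  · intro h
    exact ⟨embLaurent_mem_antisymmSupported b, fun π hπ μ => (smul_eq_self_iff_coeff ⟨π, hπ⟩ b).1 (h ⟨π, hπ⟩) μ⟩
  · rintro ⟨-, h⟩ π
    exact (smul_eq_self_iff_coeff π b).2 (h π.1 π.2)

end Weyl

/-! ## §2 The Siegel retraction `ℤ^N → Λ⁻` -/

section Retract

/-- `ι(μ) = siegelExp N μ` is antisymmetric. [cite: BruhatTits1972, (4.4.3)] -/
theorem siegelExp_mem_antisymmLattice (μ : Fin (N / 2) → ℤ) : siegelExp N μ ∈ antisymmLattice N := by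
  intro i
  obtain ⟨x, rfl⟩ := (blockSum (Nat.mul_div_le N 2)).surjective i
  rcases x with (j | j) | j
  · rw [blockSum_inl_inl, rev_castLE (Nat.mul_div_le N 2), siegelExp_hiIndex, siegelExp_castLE, Fin.rev_rev]
  · rw [blockSum_inl_inr, rev_midIndex, siegelExp_midIndex, siegelExp_midIndex, neg_zero]
  · rw [blockSum_inr, rev_hiIndex, siegelExp_castLE, siegelExp_hiIndex, neg_neg]

variable (N) in
/-- **The Siegel retraction `ℤ^N →+ Λ⁻`**, `μ ↦ ι(μ|_{[0,n)})` — the identity on `Λ⁻`. [cite: BruhatTits1972, (4.4.3)] -/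
def siegelRetract : (Fin N → ℤ) →+ antisymmLattice N where
  toFun μ := ⟨siegelExp N (μ ∘ Fin.castLE (le_of_two_mul_le (Nat.mul_div_le N 2))), siegelExp_mem_antisymmLattice _⟩
  map_zero' := Subtype.ext (by simp only [Pi.zero_comp]; exact (siegelExpHom N).map_zero)
  map_add' μ ν := Subtype.ext (by simp only [Pi.add_comp]; exact siegelExp_add _ _)

/-- The Siegel retraction is the identity on `Λ⁻`. [cite: BruhatTits1972, (4.4.3)] -/
theorem siegelRetract_coe (m : antisymmLattice N) : siegelRetract N (m : Fin N → ℤ) = m :=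
  Subtype.ext (eq_siegelExp_of_rev m.2).symm

end Retract

/-! ## §3 Every character of `ℋ(U(σ, J₀), K₀)` is a `λ_β` -/

section Characters

variable {K : Type*} [Field K] [Valued K ℤᵐ⁰] {σ : K →+* K} {ϖ : K}

namespace UnramifiedLocalConjDatum

/-- **CARTIER COR. 4.2 (EXISTENCE) FOR `U(σ, J₀^{(N)})` IN EVERY RANK**: every `ℂ`-algebra homomorphism
`ψ : ℋ(U(σ, J₀^{(N)}), K₀) → ℂ` is an unramified Hecke eigencharacter `λ_β : T ↦ 𝒮(T)(β)` for some `β ∈ (ℂˣ)^N` (`σ ≠ id`,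
finite residue field). [cite: CartierCorvallis1979, §IV Cor. 4.2] [cite: Satake1963, §6] [cite: Minguez2011, §4] -/
theorem exists_eq_heckeEigencharacter (hd : UnramifiedLocalConjDatum σ ϖ) [Finite 𝓀[K]] (hσ : ∃ x : K, σ x ≠ x)
    (ψ : heckeAlgebra ℂ (unitaryGroupOfForm σ ((StdForm.antidiagonal N).over K)) (unitaryInt σ ((StdForm.antidiagonal N).over K))
      →ₐ[ℂ] ℂ) :
    ∃ β : Fin N → ℂˣ, ψ = hd.heckeEigencharacter β := by
  classical
  letI := weylAction N
  -- the subalgebra `A = ι_*⁻¹(ℂ[Λ⁻]^W)` of `B = ℂ[Λ⁻]` contains the `W`-fixed points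
  set A : Subalgebra ℂ (AddMonoidAlgebra ℂ (antisymmLattice N)) := (unitarySatakeTarget ℂ N).comap (embLaurent N) with hAdef
  have hA : ∀ b : AddMonoidAlgebra ℂ (antisymmLattice N), (∀ g : revCentralizer N, g • b = b) → b ∈ A := fun b hb =>
    (Subalgebra.mem_comap _ _ _).2 ((forall_smul_eq_self_iff_mem_unitarySatakeTarget b).1 hb)
  -- the character `φ = ψ ∘ 𝒮⁻¹ ∘ ι_*` of `A`
  set toTarget : A →ₐ[ℂ] unitarySatakeTarget ℂ N :=
    ((embLaurent N).comp A.val).codRestrict (unitarySatakeTarget ℂ N) fun a => (Subalgebra.mem_comap _ _ _).1 a.2 with htoTarget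
  set φ : A →ₐ[ℂ] ℂ := (ψ.comp (hd.satakeAlgEquiv (N := N) hσ).symm.toAlgHom).comp toTarget with hφ
  -- extend `φ` to `Ψ : ℂ[Λ⁻] → ℂ`, a character `χ₀` of `Λ⁻`, extended to `χ` on `ℤ^N`, `χ = (β^·)`
  obtain ⟨Ψ, hΨ⟩ := exists_algHom_extend_of_fixedPoints A hA φ
  set χ₀ : Multiplicative (antisymmLattice N) →* ℂ := (AddMonoidAlgebra.lift ℂ ℂ (antisymmLattice N)).symm Ψ with hχ₀
  have hΨχ : Ψ = AddMonoidAlgebra.lift ℂ ℂ (antisymmLattice N) χ₀ := by rw [hχ₀, Equiv.apply_symm_apply]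
  set χ : Multiplicative (Fin N → ℤ) →* ℂ := χ₀.comp (AddMonoidHom.toMultiplicative (siegelRetract N)) with hχ
  have hχχ₀ : χ.comp (AddMonoidHom.toMultiplicative (antisymmLattice N).subtype) = χ₀ := by
    refine MonoidHom.ext fun m => ?_
    show χ₀ (Multiplicative.ofAdd (siegelRetract N ((antisymmLattice N).subtype (Multiplicative.toAdd m)))) = χ₀ m
    rw [AddSubgroup.coe_subtype, siegelRetract_coe]
    rfl
  obtain ⟨β, hβ⟩ := exists_laurentMonomialHom_eq χ
  refine ⟨β, AlgHom.ext fun T => ?_⟩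
  -- unwind: `ψ T = φ(b_T) = Ψ(b_T) = χ(𝒮 T) = 𝒮(T)(β)`
  have hST := hd.satakeTransform_mem_unitarySatakeTarget hσ T
  obtain ⟨bT, hbT⟩ := (AlgHom.mem_range _).1 (((mem_unitarySatakeTarget_iff _).1 hST).1 |> (mem_antisymmSupported_iff _).2)
  have hbT' : embLaurent N bT = hd.satakeTransform T := hbT
  have hbA : bT ∈ A := (Subalgebra.mem_comap _ _ _).2 (by rw [hbT']; exact hST)
  have h1 : ψ T = φ ⟨bT, hbA⟩ := by
    show ψ T = ψ ((hd.satakeAlgEquiv (N := N) hσ).symm (toTarget ⟨bT, hbA⟩))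
    congr 1
    refine ((AlgEquiv.symm_apply_eq _).2 (Subtype.ext ?_)).symm
    rw [coe_satakeAlgEquiv, htoTarget, AlgHom.coe_codRestrict, AlgHom.comp_apply, Subalgebra.coe_val]
    exact hbT'
  rw [h1, ← hΨ ⟨bT, hbA⟩, hd.heckeEigencharacter_apply, laurentEvalAt, hβ, ← hbT', embLaurent_apply, lift_mapDomain, hχχ₀, hΨχ]

end UnramifiedLocalConjDatum

end Characters

end Literature.NumberTheory.Automorphic.HermitianLattice

end
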